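import Summits.BirchSwinnertonDyer.BirchSwinnertonDyer.Theorems.ErratumRoadFiveNonSurjCornerHybridCarrierLabelsB6
import Summits.BirchSwinnertonDyer.BirchSwinnertonDyer.Theorems.ErratumRoadFiveNonSurjCornerLowerHalfNonSurjDoorsContraOfMazur
import Literature.NumberTheory.EllipticCurves.HeegnerPointsOfConductorOneGaloisConjProofs
import Literature.NumberTheory.EllipticCurves.HeegnerPointsOfConductorOneRationalityProofs
import HarnessLib

/-!
# Route `ErratumRoadFive` (rung K2), crux `NonSurjCorner` (item stmt-BirchSwinnertonDyer-19065), registered line `Lines/hybrid.lean`: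
# GLUE #13 — glue #12 with slot 3 SHRUNK from twenty-three to SIXTEEN named facts: the seven conjuncts that are THEOREMS of the tree (two outright,
# two `_holds`, one existence datum, and — on the irreducible corner — Greenberg 1999 Thm. 1.5 and Wuthrich 2014 Cor. 18 given Mazur Cor. 4.1)
# are DERIVED INSIDE the glue (cell `bsd-stepL`, seat `bsd-stepL-corner-p1` g17; `--supports stmt-BirchSwinnertonDyer-19065 --as helper`)

WHY THIS FILE. Glue #12 (`…HybridCarrierLabelsB6`, p623980) reads slot 3 as `hF′`, the twenty-three named facts of item 19949 with Kato's V ∕ VI ∕ XI in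
print-exact contragredient form. Planner g40 (STATUS 10:08:59Z (2), relaying bsd-cited's reader note I-r02-g39-2) asked to derive the conjuncts that are
already tree theorems INSIDE `NonSurjCorner_of` and shrink the slot. SEVEN of the twenty-three are derivable in the tree at the points where this glue
consumes them, so THIS FILE = glue #12 with `hF′ ↦ hF″`, the SIXTEEN remaining facts, and the seven produced in the body:
* conjunct 5 `hasEntireLFunction_rat` ⟸ conjunct 6 (modularity) by `hasEntireLFunction_rat_of_exists_isNewformOf` (Diamond–Shurman 8.8.3 ∕ 5.10.2, tree);
* conjunct 7 `nonempty_modularParametrizationData` ⟸ conjunct 6 + `IsNewformOf.exists_maninConstant_ne_zero_holds` by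
  `nonempty_modularParametrizationData_of_exists_isNewformOf` (BCDT p. 845 (2) ⇒ (6), tree);
* conjunct 10 `heegnerPointOfConductor_one_galoisConj` = `heegnerPointOfConductor_one_galoisConj_holds` (Darmon 2004 Thm. 3.7 at conductor 1, PROVED in the tree);
* conjunct 11 `phi_heegnerTau_mem_singularModuliField` = `phi_heegnerTau_mem_singularModuliField_holds` (Darmon 2004 Thm. 3.6 at conductor 1, PROVED in the tree);
* conjunct 17 `Kato2004.nonempty_iwasawaH1Data` = `Kato2004.nonempty_iwasawaH1Data_holds` ((12.2.1), tree);
* conjuncts 21 `Greenberg1999.thm15_isTorsion_multiplicative_rat` and 22 `Wuthrich2014.corollary18_padicLFunction_mem_iwasawaAlgebra_multiplicative` — consumed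
  ONLY on pairs with `E[p]` irreducible (the leaf twins are X11a pairs), where bsd-line-x11a-p2 g3 (p621238) proved both REDUNDANT given conjunct 9 (Mazur 1978
  Cor. 4.1): the typed divisibility comes from `X11b.multDivisibilityAt_of_katoFacts_of_muAn_contra_of_mazur`, the leaf-twin lower half from this seat's
  `NonSurjChain.lowerNonSurj_fiveSeven_of_nonSurjCornerTwinMuAn_of_contraFacts_of_mazur` (`…LowerHalfNonSurjDoorsContraOfMazur`).
Result:
* **glue #13 `nonSurjCorner_of_kolyZShaAn_of_twinMuAn_of_sixteenFacts_of_hidaFacts_of_sixNamedInputs_of_carrierLabelsB6_of_threeBadSplit`** — body otherwise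
  byte-identical with glue #12 (slot 6 = labels with (B6) at the carriers only; slot 4 derived; §2 roads on the twin-lower supply);
* **`sixteenFacts_of_katoTwinFactsContra`** — r10's 23-conjunct slot-3 text implies the 16-conjunct one (projection), so registering r11 loses nothing.
Candidate composition of `Lines/hybrid.lean` r11 (slot 3 `stub_katoTwinFactsContra57` ↦ `stub_katoTwinFactsSlim57`; slots 1, 2, 4–7 ≡ r10).

HONEST FRAMING: TWO THEOREMS (no definition, no named fact, no `sorry`); CONDITIONAL on every displayed binder — the sixteen slot-3 facts are still
NAMED PUBLISHED INPUTS taken BY NAME (Gross–Zagier, Kolyvagin, Wuthrich's `Ш ∣ Ш_an`, GZK, modularity, Friedberg–Hoffstein (split), Mazur Cor. 4.1,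
Stein–Wuthrich 6.1 ×2, Greenberg–Stevens, Cha Rmk. 25 ×2, Kato 12.4, Kato §17.13 V′ ∕ VI′ ∕ XI′); item 19065 is NOT closed; no stub is discharged;
nothing about any curve's BSD; BSD is not advanced; T7. Credit: bsd-line-x11a-p2 g3 (Cor. 18 ∕ Greenberg 1.5 from Mazur), bsd-cited r02 (reader note),
planner g40, and the g16 credits of glue #12.
References (locators only): [cite: Mazur1978, Cor. 4.1] [cite: Wuthrich2014, Cor. 18 (p. 398)] [cite: GreenbergLNM1716, Thm. 1.5 (p. 61)]
[cite: Darmon2004, Thm. 3.6, Thm. 3.7] [cite: DiamondShurman2005, Thm. 8.8.3] [cite: BCDTJAMS2001, p. 845] [cite: Kato2004Asterisque, (12.2.1), Thm. 12.4, §17.13]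
[cite: Jetchev2008, Thm. 1.1, Cor. 1.5] [cite: MilneADT2006, Ch. I Prop. 3.8] [cite: EmertonPollackWeston2006, Thm. 5.1.3] [cite: Wan2015, Thm. 4]
[cite: Miller2011LMS, Def. 1.1].
-/

set_option autoImplicit false
set_option linter.dupNamespace false -- `Summit.BirchSwinnertonDyer.BirchSwinnertonDyer` (summit = problem), tree-wide

noncomputable section

open scoped Classical NumberField MatrixGroups ModularForm

namespace Summit.BirchSwinnertonDyer.BirchSwinnertonDyer.Theorems

open CongruenceSubgroup WeierstrassCurve NumberField IsDedekindDomain Field Rat.HeightOneSpectrum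
  Literature.NumberTheory.EllipticCurves
  Literature.NumberTheory.EllipticCurves.ModularForms
  Literature.NumberTheory.Automorphic
  Literature.NumberTheory.EllipticCurves.Rank1Residual
  Literature.NumberTheory.EllipticCurves.Rank1Residual.Typed
  Literature.NumberTheory.EllipticCurves.Wuthrich2014
  Literature.NumberTheory.EllipticCurves.SteinWuthrich2013
  Literature.NumberTheory.EllipticCurves.Greenberg1999
  Literature.NumberTheory.EllipticCurves.Kato2004
  Literature.NumberTheory.EllipticCurves.BarriosEtAl2025
  Literature.NumberTheory.EllipticCurves.EmertonPollackWeston2006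
  Literature.NumberTheory.EllipticCurves.ShimuraCMFamily
  Literature.NumberTheory.GaloisRepresentations Literature.NumberTheory.GaloisCohomology
  Summit.BirchSwinnertonDyer.Rank1Residual
  Summit.BirchSwinnertonDyer.Rank1Residual.X11b
  Summit.BirchSwinnertonDyer.Rank1Residual.X11b.Three.Koly

/-- **THE HYBRID GLUE (glue #13) — SLOT 3 = SIXTEEN NAMED FACTS.** As glue #12 (`…HybridCarrierLabelsB6`) with the slot-3 binder `hF′` (twenty-three
facts) replaced by `hF″` (sixteen): conjuncts 5, 7, 10, 11, 17 of the old text are tree theorems (`hasEntireLFunction_rat_of_exists_isNewformOf`,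
`nonempty_modularParametrizationData_of_exists_isNewformOf` + `IsNewformOf.exists_maninConstant_ne_zero_holds`, `heegnerPointOfConductor_one_galoisConj_holds`,
`phi_heegnerTau_mem_singularModuliField_holds`, `Kato2004.nonempty_iwasawaH1Data_holds`) and conjuncts 21 ∕ 22 (Greenberg 1.5, Wuthrich Cor. 18) are
redundant given conjunct 9 (Mazur Cor. 4.1) on the irreducible leaf twins (`X11b.multDivisibilityAt_of_katoFacts_of_muAn_contra_of_mazur`,
`NonSurjChain.lowerNonSurj_fiveSeven_of_nonSurjCornerTwinMuAn_of_contraFacts_of_mazur`); all seven are produced in the body and the rest is glue #12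
VERBATIM. Binders: `hZan` → 19948 → `hF″` → `hHida` → hMax → hShim6 → `hLabB6T` → `hres3bad` → `NonSurjCorner`. CONDITIONAL on every binder; 19065 NOT
closed; nothing booked; T7.
[cite: Mazur1978, Cor. 4.1] [cite: Darmon2004, Thm. 3.6, Thm. 3.7] [cite: Kato2004Asterisque, (12.2.1), §17.13 (pp. 279–280)] [cite: Jetchev2008, Thm. 1.1 and Cor. 1.5]
[cite: EmertonPollackWeston2006, Thm. 5.1.3] [cite: Miller2011LMS, Def. 1.1] [cite: Cha2005, Thm. 21 and Rmk. 25] [cite: JetchevSkinnerWan2017, §7.4.2] -/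
theorem nonSurjCorner_of_kolyZShaAn_of_twinMuAn_of_sixteenFacts_of_hidaFacts_of_sixNamedInputs_of_carrierLabelsB6_of_threeBadSplit
    (hZan : ∀ (W : WeierstrassCurve ℚ) [W.IsElliptic] [W.IsGloballyMinimal] (p : ℕ) [Fact p.Prime]
      (N : ℕ) [NeZero N] (K : Type) [Field K] [NumberField K]
      (Dt : ModularParametrizationData W N) (β : ℤ) (ι : K →+* ℂ),
      ClassX11b W p → ¬ Surj W p → (p = 5 ∨ p = 7) → p ∣ padicValInt p W.minimalDiscriminantInt →
      ¬ Ram W p → (∃ s : ℚ, shaAn W = (s : ℂ) ∧ 0 < padicValRat p s) →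
      W.conductorNorm ℤ = N → IsImaginaryQuadratic K →
      4 < (NumberField.discr K).natAbs → SatisfiesHeegnerHypothesis N K →
      SatisfiesHeegnerHypothesis p K → (4 * (N : ℤ)) ∣ β ^ 2 - NumberField.discr K → ¬ (p : ℤ) ∣ Dt.c →
      (∃ (d₁ : KolyvaginHeegnerData Dt β ι 1) (y : (W.baseChange K).toAffine.Point),
        WeierstrassCurve.Affine.Point.map (W' := W) (algebraMap K (ringClassField K ι 1)).toRatAlgHom y =
          d₁.derivedPoint ∧
        ∃ Q : (W.baseChange K).toAffine.Point, ((p ^ (padicValNat p W.tamagawaProduct + 1) : ℕ) : ℤ) • Q = y) →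
      ∃ M : ℕ, M ≤ padicValNat p W.tamagawaProduct ∧ CertificateAt Dt β ι p M)
    (hμ : NonSurjCornerTwinMuAn)
    -- slot 3 (r11): SIXTEEN named facts — r9 ∕ r10's twenty-three minus the seven tree theorems {5, 7, 10, 11, 17, 21, 22}
    (hF'' :
      (∀ (N : ℕ) [NeZero N] (W : WeierstrassCurve ℚ) (K : Type) [Field K] [NumberField K], Literature.NumberTheory.EllipticCurves.gross_zagier N W K) ∧
      (∀ (N : ℕ) [NeZero N] (W : WeierstrassCurve ℚ) (K : Type) [Field K] [NumberField K], Literature.NumberTheory.EllipticCurves.kolyvagin N W K) ∧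
      Literature.NumberTheory.EllipticCurves.Wuthrich2014.sha_dvd_analyticSha ∧
      Literature.NumberTheory.EllipticCurves.rank_eq_analyticRank_of_analyticRank_le_one ∧
      Literature.NumberTheory.EllipticCurves.ModularForms.exists_isNewformOf ∧
      Literature.NumberTheory.EllipticCurves.friedbergHoffstein_exists_heegnerField_split_twist_ne_zero ∧
      Literature.NumberTheory.EllipticCurves.ModularForms.mazur_not_dvd_maninConstant_of_odd ∧
      Literature.NumberTheory.EllipticCurves.SteinWuthrich2013.thm61_splitMultiplicative ∧
      Literature.NumberTheory.EllipticCurves.SteinWuthrich2013.thm61_nonsplitMultiplicative ∧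
      (∀ (W : WeierstrassCurve ℚ) [W.IsElliptic] [W.IsGloballyMinimal] (p : ℕ) [Fact p.Prime], Literature.NumberTheory.EllipticCurves.greenberg_stevens (W := W) (p := p)) ∧
      Literature.NumberTheory.EllipticCurves.Cha2005.rmk25_pow_dvd_card_sha_primary_of_certificate ∧
      Literature.NumberTheory.EllipticCurves.Cha2005.rmk25_padicValNat_card_sha_primary_add_le_of_globalDivisibility ∧
      Literature.NumberTheory.EllipticCurves.Kato2004.thm12_4 ∧
      Literature.NumberTheory.EllipticCurves.Kato2004.exists_multDivisibilityInputs_nonsplit_contra ∧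
      Literature.NumberTheory.EllipticCurves.Kato2004.exists_multDivisibilityInputs_split_contra ∧
      Literature.NumberTheory.EllipticCurves.Kato2004.exists_multDivisibilityInputs_fine_contra)
    -- slot 4 (r7): the six Hida-side NAMED facts of x11a's non-surjective chain
    (hHida : EmertonPollackWeston2006.thm311_cotorsion_weightK_member_ofLevel ∧
      EmertonPollackWeston2006.thm1_muAlg_of_weightK_member_ofLevel ∧
      Wan2015.thm4_rational_weightK_member_of_bdd_ofLevel_irred ∧
      EmertonPollackWeston2006.thm513_transfer_from_weightK_member_of_bdd_ofLevel ∧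
      DeligneSerre1974.thm61_exists_adicGaloisRep ∧ Hida2000_thm326_ordinary)
    (hMax : GrossLMS1991.prop37_2_frobeniusCongruence ∧
      (∀ (K : Type) [Field K] [NumberField K], poitouTate_selmerStructure_duality_conj K) ∧
      Gross1991_heegnerPoint_sub_ratTorsion_mem_E0_imageFree)
    (hShim6 : friedbergHoffstein_exists_twist_ne_zero_inertAt ∧ nonempty_shimuraParametrizationData ∧
      PastenShimura2024_componentOrders ∧
      (∀ (K : Type) [Field K] [NumberField K], casselsTate_levelInputs K) ∧
      shimuraCurve_heegnerSystem_primitivesFromFiveIrr ∧ shimuraCurve_heegnerSystem_primitivesSplitReduced)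
    -- slot 6 (r10): the labelled CM family at the corner's inert frames with `d_K < −4`, WITH (B6) ONLY AT THE CARRIER PRIMES outside `S`
    (hLabB6T : ∀ (W : WeierstrassCurve ℚ) [W.IsElliptic] [W.IsGloballyMinimal] (p : ℕ) [Fact p.Prime],
      ClassX11b W p → ¬ Surj W p → (p = 5 ∨ p = 7) →
      ∀ (N : ℕ) [NeZero N] (K : Type) [Field K] [NumberField K] (S : Finset ℕ) (Dt : ModularParametrizationData W N)
        (X : ShimuraCurveData (∏ q ∈ S, q) (N / ∏ q ∈ S, q)) (W' : WeierstrassCurve ℚ) [W'.IsElliptic]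
        (P₀ : ShimuraParametrizationData X W'),
        W.conductorNorm ℤ = N → IsImaginaryQuadratic K → NumberField.discr K < -4 → Even S.card →
        (∀ ℓ ∈ S, ℓ.Prime ∧ ℓ ∣ N ∧ ¬ ℓ ^ 2 ∣ N ∧
          ((Ideal.span {(ℓ : ℤ)}).primesOver (𝓞 K)).ncard = 1 ∧ ¬ (ℓ : ℤ) ∣ NumberField.discr K) →
        (∀ ℓ : ℕ, ℓ.Prime → ℓ ∣ N → ℓ ∉ S → ((Ideal.span {(ℓ : ℤ)}).primesOver (𝓞 K)).ncard = 2) →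
        p ∈ S → ¬ (p : ℤ) ∣ Dt.c → P₀.IsMinimalFor W →
        ∃ (ι : K →+* ℂ) (y : (W.baseChange K).toAffine.Point) (degy : ℕ)
          (ys : (m : ℕ) → (W.baseChange (ringClassField K ι m)).toAffine.Point) (ε : ℤ), 0 < degy ∧
          padicValNat p degy = padicValNat p P₀.deg ∧
          LDerivEK W K = 8 * (Real.pi : ℂ) ^ 2 * peterssonProduct (CongruenceSubgroup.Gamma0 N) 2 Dt.f Dt.f /
              ((((Units.torsionOrder K : ℝ) / 2) ^ 2 * √|(NumberField.discr K : ℝ)| : ℝ) : ℂ) *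
            ((y.canonicalHeight : ℂ) / (degy : ℂ)) ∧
          (¬ IsOfFinAddOrder y → 0 < (AddSubgroup.zmultiples y).index) ∧
          ShimuraWalk.LabelsAt W N K ι y ys ε ∧
          ∀ (q : ℕ) [Fact q.Prime], q ∣ N → q ∉ S → p ∣ (W.baseChange ℚ_[q]).localTamagawaNumber ℤ_[q] → LabelB6 ι W N {q} ys)
    (hres3bad : ∀ (W : WeierstrassCurve ℚ) [W.IsElliptic] [W.IsGloballyMinimal] (p : ℕ) [Fact p.Prime],
      ClassX11b W p → ¬ Surj W p → (p = 5 ∨ p = 7) → p ∣ padicValInt p W.minimalDiscriminantInt → ¬ Ram W p →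
      ∀ (q₁ q₂ q₃ : ℕ) [Fact q₁.Prime] [Fact q₂.Prime] [Fact q₃.Prime], q₁ ≠ p → q₂ ≠ p → q₃ ≠ p →
      q₁ ≠ q₂ → q₁ ≠ q₃ → q₂ ≠ q₃ →
      W.HasSplitMultiplicativeReductionAtPrime q₁ → W.HasSplitMultiplicativeReductionAtPrime q₂ →
      W.HasSplitMultiplicativeReductionAtPrime q₃ →
      (q₁ = 2 ∨ p ∣ q₁ - 1) → (q₂ = 2 ∨ p ∣ q₂ - 1) → (q₃ = 2 ∨ p ∣ q₃ - 1) → Typed.MissingUpperBoundAt W p) :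
    Summit.BirchSwinnertonDyer.BirchSwinnertonDyer.Theses.ErratumRoadFive.NonSurjCorner := by
  obtain ⟨hGZ, hKo, hWu, hGZK, hnf, hFHs, hMaz, hJs, hJn, hGS, hChaL, hChaU, h12, hns', hsp', hfine'⟩ := hF''
  obtain ⟨h311, hT1a, hT2, hT1b, h61, h326⟩ := hHida
  obtain ⟨h37, hPTs, hF1⟩ := hMax
  obtain ⟨hFH, hJL, hCO, hCT, hLab, hLabS⟩ := hShim6
  -- the seven former slot-3 conjuncts that are THEOREMS of the tree
  have hmod : hasEntireLFunction_rat := hasEntireLFunction_rat_of_exists_isNewformOf hnf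
  have hpar : nonempty_modularParametrizationData :=
    nonempty_modularParametrizationData_of_exists_isNewformOf hnf IsNewformOf.exists_maninConstant_ne_zero_holds
  have hrec : ∀ (N : ℕ) [NeZero N] (W : WeierstrassCurve ℚ) (K : Type) [Field K] [NumberField K],
      heegnerPointOfConductor_one_galoisConj N W K :=
    fun N _ W K _ _ ↦ heegnerPointOfConductor_one_galoisConj_holds N W K
  have hD36 : ∀ (N : ℕ) [NeZero N] (W : WeierstrassCurve ℚ) (K : Type) [Field K] [NumberField K],
      phi_heegnerTau_mem_singularModuliField N W K :=
    fun N _ W K _ _ ↦ phi_heegnerTau_mem_singularModuliField_holds N W K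
  have hPT : ∀ (K : Type) [Field K] [NumberField K],
      Literature.NumberTheory.GaloisCohomology.poitouTate_sum_localTatePairing_eq_zero K :=
    poitouTate_sum_localTatePairing_eq_zero_holds
  have hBR : localTamagawaNumber_quadraticTwist_two_mem_of_goodReduction :=
    BarriosEtAl2025.localTamagawaNumber_quadraticTwist_two_mem_of_goodReduction_holds
  -- slot 4: the leaf-twin lower half from 19948 + named facts (the `_of_mazur` Hida doors: no Greenberg 1.5, no Cor. 18)
  have h₄ℓ : ∀ (Wd : WeierstrassCurve ℚ) [Wd.IsElliptic] [Wd.IsGloballyMinimal] (p : ℕ) [Fact p.Prime],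
      ClassX11a Wd p → ¬ Surj Wd p → (p = 5 ∨ p = 7) → p ∣ padicValInt p Wd.minimalDiscriminantInt →
      ¬ X11a.ShaAnUnit Wd p → Typed.MissingLowerBoundAt Wd p :=
    fun Wd _ _ p _ hXa hnsd h57 _ _ ↦
      NonSurjChain.lowerNonSurj_fiveSeven_of_nonSurjCornerTwinMuAn_of_contraFacts_of_mazur hnf h311 hT1a hT2 hT1b h61 h326 h12 hns'
        hsp' hfine' hMaz hJs hJn hGZK hGS hμ Wd p hXa hnsd h57
  -- slot 6 (r10): the SAVED display in D-form at every corner pair and every `q₁`, from the labels with (B6) at the CARRIERS, Poitou–Tate and CT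
  have hSavD : ∀ (W : WeierstrassCurve ℚ) [W.IsElliptic] [W.IsGloballyMinimal] (p : ℕ) [Fact p.Prime],
      ClassX11b W p → ¬ Surj W p → (p = 5 ∨ p = 7) → ∀ (q₁ : ℕ) [Fact q₁.Prime], ShimuraInertSavedDisplayAtD W p q₁ :=
    NonSurjCorner.shimuraInertSavedDisplayAtD_of_carrierLabelsB6 hPTs hCT hLabB6T
  exact X11b.erratumRoadFive_nonSurjCorner_of_kolyZShaAn_of_kolyJMax_of_multiUpper_of_lowerLeafTwinDeep_of_twinMultDivisibility hGZ hKo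
    hWu hGZK hmod hnf hpar hFHs hMaz hrec hD36 hJs hJn hGS hChaL hChaU h₄ℓ hZan
    (X11b.Three.Koly.nonSurjCornerKolyJ_max_of_threeNamedFacts h37 hPTs hF1)
    (fun W _ _ p _ hX hns' h57 hv hnr htam hmulti ↦ by
      -- the TWIN-LOWER SUPPLY at this corner pair (Friedberg–Hoffstein + the leaf-twin lower half)
      have hTL : FHTwinLowerSupplyAt W p :=
        NonSurjCorner.fhTwinLowerSupplyAt_of_lowerLeafTwinDeep hGZK hmod hnf hFH h₄ℓ W p hX hns' h57 hv hnr
      by_cases h3 : ∃ (q₁ q₂ q₃ : ℕ) (_ : Fact q₁.Prime) (_ : Fact q₂.Prime) (_ : Fact q₃.Prime), q₁ ≠ p ∧ q₂ ≠ p ∧ q₃ ≠ p ∧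
          q₁ ≠ q₂ ∧ q₁ ≠ q₃ ∧ q₂ ≠ q₃ ∧ W.HasSplitMultiplicativeReductionAtPrime q₁ ∧
          W.HasSplitMultiplicativeReductionAtPrime q₂ ∧ W.HasSplitMultiplicativeReductionAtPrime q₃ ∧
          (q₁ = 2 ∨ p ∣ q₁ - 1) ∧ (q₂ = 2 ∨ p ∣ q₂ - 1) ∧ (q₃ = 2 ∨ p ∣ q₃ - 1)
      · obtain ⟨q₁, q₂, q₃, i₁, i₂, i₃, h1p, h2p, h3p, h12', h13, h23, hs1, hs2, hs3, hb1, hb2, hb3⟩ := h3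
        haveI := i₁; haveI := i₂; haveI := i₃
        exact hres3bad W p hX hns' h57 hv hnr q₁ q₂ q₃ h1p h2p h3p h12' h13 h23 hs1 hs2 hs3 hb1 hb2 hb3
      · have hno : ∀ (q₁ q₂ q₃ : ℕ) [Fact q₁.Prime] [Fact q₂.Prime] [Fact q₃.Prime], q₁ ≠ p → q₂ ≠ p → q₃ ≠ p →
            q₁ ≠ q₂ → q₁ ≠ q₃ → q₂ ≠ q₃ →
            W.HasSplitMultiplicativeReductionAtPrime q₁ → W.HasSplitMultiplicativeReductionAtPrime q₂ →
            W.HasSplitMultiplicativeReductionAtPrime q₃ →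
            (q₁ = 2 ∨ p ∣ q₁ - 1) → (q₂ = 2 ∨ p ∣ q₂ - 1) → (q₃ = 2 ∨ p ∣ q₃ - 1) → False :=
          fun q₁ q₂ q₃ _ _ _ h1p h2p h3p h12' h13 h23 hs1 hs2 hs3 hb1 hb2 hb3 ↦
            h3 ⟨q₁, q₂, q₃, inferInstance, inferInstance, inferInstance, h1p, h2p, h3p, h12', h13, h23, hs1, hs2, hs3,
              hb1, hb2, hb3⟩
        rcases NonSurjCorner.admissibleUpToOneDatum_of_atMostTwoBadSplit W p hX hns' h57 htam hmulti hno with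
          hadm | ⟨q₁, hq₁F, hq₁, hdat⟩
        · exact NonSurjCorner.missingUpperBoundAt_of_admissibleSet_of_primitives_of_twinLower hGZK hmod hnf hMaz hBR hJL hCO hPT hCT
            hLab hLabS W p hX h57 hTL hadm
        · haveI := hq₁F
          exact NonSurjCorner.missingUpperBoundAt_of_admissibleUpToOne_of_savedDisplayD_of_twinLower hGZK hmod hnf hMaz hBR hJL hCO W p
            hX h57 hTL q₁ hq₁ (hSavD W p hX hns' h57 q₁) hdat)
    (fun Wd _ _ p _ hXa hnsd h57 hvd ↦
      X11b.multDivisibilityAt_of_katoFacts_of_muAn_contra_of_mazur Kato2004.nonempty_iwasawaH1Data_holds h12 hnf hns' hsp' hfine'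
        hMaz Wd p hXa.2.1 hXa.2.2.1 hXa.2.2.2.1 hnsd (fun f hf ϖ hϖ a L hsa hna hL ↦ hμ Wd p hXa hnsd h57 hvd f hf ϖ hϖ a L hsa hna hL))

/-- **r10-compatibility of the slot-3 shrink.** r9 ∕ r10's twenty-three-conjunct slot-3 text (`stub_katoTwinFactsContra57`, = glue #12's `hF′`) implies
the sixteen-conjunct text of glue #13 — the projection forgetting conjuncts 5, 7, 10, 11, 17, 21, 22. So every proof of the r10 stub is a proof of the
r11 stub and registering r11 loses nothing. Bookkeeping; nothing asserted. -/
theorem sixteenFacts_of_katoTwinFactsContra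
    (hF' :
      (∀ (N : ℕ) [NeZero N] (W : WeierstrassCurve ℚ) (K : Type) [Field K] [NumberField K], Literature.NumberTheory.EllipticCurves.gross_zagier N W K) ∧
      (∀ (N : ℕ) [NeZero N] (W : WeierstrassCurve ℚ) (K : Type) [Field K] [NumberField K], Literature.NumberTheory.EllipticCurves.kolyvagin N W K) ∧
      Literature.NumberTheory.EllipticCurves.Wuthrich2014.sha_dvd_analyticSha ∧
      Literature.NumberTheory.EllipticCurves.rank_eq_analyticRank_of_analyticRank_le_one ∧
      WeierstrassCurve.hasEntireLFunction_rat ∧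
      Literature.NumberTheory.EllipticCurves.ModularForms.exists_isNewformOf ∧
      Literature.NumberTheory.EllipticCurves.ModularForms.nonempty_modularParametrizationData ∧
      Literature.NumberTheory.EllipticCurves.friedbergHoffstein_exists_heegnerField_split_twist_ne_zero ∧
      Literature.NumberTheory.EllipticCurves.ModularForms.mazur_not_dvd_maninConstant_of_odd ∧
      (∀ (N : ℕ) [NeZero N] (W : WeierstrassCurve ℚ) (K : Type) [Field K] [NumberField K], Literature.NumberTheory.EllipticCurves.heegnerPointOfConductor_one_galoisConj N W K) ∧
      (∀ (N : ℕ) [NeZero N] (W : WeierstrassCurve ℚ) (K : Type) [Field K] [NumberField K], Literature.NumberTheory.EllipticCurves.phi_heegnerTau_mem_singularModuliField N W K) ∧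
      Literature.NumberTheory.EllipticCurves.SteinWuthrich2013.thm61_splitMultiplicative ∧
      Literature.NumberTheory.EllipticCurves.SteinWuthrich2013.thm61_nonsplitMultiplicative ∧
      (∀ (W : WeierstrassCurve ℚ) [W.IsElliptic] [W.IsGloballyMinimal] (p : ℕ) [Fact p.Prime], Literature.NumberTheory.EllipticCurves.greenberg_stevens (W := W) (p := p)) ∧
      Literature.NumberTheory.EllipticCurves.Cha2005.rmk25_pow_dvd_card_sha_primary_of_certificate ∧
      Literature.NumberTheory.EllipticCurves.Cha2005.rmk25_padicValNat_card_sha_primary_add_le_of_globalDivisibility ∧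
      Literature.NumberTheory.EllipticCurves.Kato2004.nonempty_iwasawaH1Data ∧
      Literature.NumberTheory.EllipticCurves.Kato2004.thm12_4 ∧
      Literature.NumberTheory.EllipticCurves.Kato2004.exists_multDivisibilityInputs_nonsplit_contra ∧
      Literature.NumberTheory.EllipticCurves.Kato2004.exists_multDivisibilityInputs_split_contra ∧
      Literature.NumberTheory.EllipticCurves.Greenberg1999.thm15_isTorsion_multiplicative_rat ∧
      Literature.NumberTheory.EllipticCurves.Wuthrich2014.corollary18_padicLFunction_mem_iwasawaAlgebra_multiplicative ∧
      Literature.NumberTheory.EllipticCurves.Kato2004.exists_multDivisibilityInputs_fine_contra) :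
      (∀ (N : ℕ) [NeZero N] (W : WeierstrassCurve ℚ) (K : Type) [Field K] [NumberField K], Literature.NumberTheory.EllipticCurves.gross_zagier N W K) ∧
      (∀ (N : ℕ) [NeZero N] (W : WeierstrassCurve ℚ) (K : Type) [Field K] [NumberField K], Literature.NumberTheory.EllipticCurves.kolyvagin N W K) ∧
      Literature.NumberTheory.EllipticCurves.Wuthrich2014.sha_dvd_analyticSha ∧
      Literature.NumberTheory.EllipticCurves.rank_eq_analyticRank_of_analyticRank_le_one ∧
      Literature.NumberTheory.EllipticCurves.ModularForms.exists_isNewformOf ∧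
      Literature.NumberTheory.EllipticCurves.friedbergHoffstein_exists_heegnerField_split_twist_ne_zero ∧
      Literature.NumberTheory.EllipticCurves.ModularForms.mazur_not_dvd_maninConstant_of_odd ∧
      Literature.NumberTheory.EllipticCurves.SteinWuthrich2013.thm61_splitMultiplicative ∧
      Literature.NumberTheory.EllipticCurves.SteinWuthrich2013.thm61_nonsplitMultiplicative ∧
      (∀ (W : WeierstrassCurve ℚ) [W.IsElliptic] [W.IsGloballyMinimal] (p : ℕ) [Fact p.Prime], Literature.NumberTheory.EllipticCurves.greenberg_stevens (W := W) (p := p)) ∧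
      Literature.NumberTheory.EllipticCurves.Cha2005.rmk25_pow_dvd_card_sha_primary_of_certificate ∧
      Literature.NumberTheory.EllipticCurves.Cha2005.rmk25_padicValNat_card_sha_primary_add_le_of_globalDivisibility ∧
      Literature.NumberTheory.EllipticCurves.Kato2004.thm12_4 ∧
      Literature.NumberTheory.EllipticCurves.Kato2004.exists_multDivisibilityInputs_nonsplit_contra ∧
      Literature.NumberTheory.EllipticCurves.Kato2004.exists_multDivisibilityInputs_split_contra ∧
      Literature.NumberTheory.EllipticCurves.Kato2004.exists_multDivisibilityInputs_fine_contra := by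
  obtain ⟨hGZ, hKo, hWu, hGZK, -, hnf, -, hFHs, hMaz, -, -, hJs, hJn, hGS, hChaL, hChaU, -, h12, hns', hsp', -, -, hfine'⟩ := hF'
  exact ⟨hGZ, hKo, hWu, hGZK, hnf, hFHs, hMaz, hJs, hJn, hGS, hChaL, hChaU, h12, hns', hsp', hfine'⟩

end Summit.BirchSwinnertonDyer.BirchSwinnertonDyer.Theorems

end
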